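import Mathlib
import HarnessLib
import Literature.MathematicalPhysics.StatisticalMechanics.LinearisedMapNormRay
import Literature.MathematicalPhysics.StatisticalMechanics.LinearisedMapABKM

/-!
# Lemma 10.1 of [ABKM19] for the concrete torus data: `‖C_k K‖_{k+1}^{(A)} ≤ (L^d A_𝒫 c + ε(A)) ‖K‖_k^{(A)}`
# with a constant `c = c(d, L, R)` independent of `k`, `N`, `h`

`LinearisedMapNormRay.weakNormLE_opC_of_ray` is Lemma 10.1 in norm form for abstract parameters,
with some twenty side conditions on gauges, radii and boxes.  Here we take the concrete parameters
`abkmNormParams` (gauge weights `𝔥_k = 2^k h L^{−k(d−2)/2}`, `R_k = L^k`, radii `starRad`, weights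
`abkmWeightData`) on `M = L^N`, the step data of scale `k` (`s = L^k`, kernel `𝒞_{k+1}`, reference
block `B_{x₀}` with the corner of `B_{x₀}*` as base point) and VERIFY all of them for
`d ≥ 3`, `L` odd, `L ≥ 2^{d+3} + 16R`, `k + 1 ≤ N`, `⌊d/2⌋ + 2 ≤ p`, `p + d ≤ M_ord ≤ R`, `r₀ ≥ 3`,
`h² ≥ h₀²`:

* `scaleRatio d L = 2 L^{−(d−2)/2}` (`= 𝔥_{k+1}/𝔥_k`, `fieldWt_succ`), `abkmContrConst d L R`
  (`= 1536 · c_G` with the box constants `C₁ = 2R + 2`, `C₀ = 2R + 2 + ⌊d/2⌋ + 1`; independent of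
  `k`, `N`, `h`);
* the arithmetic of the radii/boxes: `two_mul_box_add_le` (`2(L^k + 2 r_k + p) ≤ L^{k+1}`),
  `boxSide_le` (`2(⌊(L^k−1)/2⌋ + r_k) ≤ (2R+2) L^k`);
* **`weakNormLE_opC_abkm`** — for a weight tower with the conclusions of Theorem 7.1
  (`AbkmWeightBounds`, integration constant `A_𝒫 ≥ 0`), the large-set parameter `A ≥ max(1, A_𝒫)`,
  the closure gain `η` at this scale and `2^{L^d} A_𝒫 A^{−(1−1/η)} ≤ 1`:
  `WeakNormLE P k K C → WeakNormLE P (k+1) (opC D K) (C · (L^d · A_𝒫 · abkmContrConst d L R + ε(A)))`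
  for `K` translation invariant, local, `C^{r₀}` with `C^{r₀}` fluctuation integrals.

Everything here is proved; no named fact (the closure gain enters as a hypothesis; it is Brydges'
Lemma 6.15, `LinearisedMapABKM.closureGain_of_brydges`).

## References
* S. Adams, S. Buchholz, R. Kotecký, S. Müller, arXiv:1910.13564, Lemma 10.1, Ch. 6.2 (6.25)–(6.28),
  Ch. 6.4 (6.40) [AdamsBuchholzKoteckyMuller2019].
-/

noncomputable section

namespace Literature.MathematicalPhysics.StatisticalMechanics.GradientRG

open scoped BigOperators Classical MatrixOrder
open Finset Matrix
open Literature.MathematicalPhysics.StatisticalMechanics.GradientFRD (cExt fourierCoeff mulMat)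
open Literature.MathematicalPhysics.StatisticalMechanics.TorusPolymer
  (IsPolymer blocks numBlocks closure reblock blockOf thicken boxCorner)
open Literature.Barriers.CriticalPhenomena.LongRangePhi4.Polymer (IsConn)
open Literature.MathematicalPhysics.QuantumFieldTheory

variable {d M : ℕ} [NeZero M]

/-! ## The scale ratio of the gauge weights and the contraction constant -/

/-- `κ_L = 𝔥_{k+1}/𝔥_k = 2 L^{−(d−2)/2}`. [cite: AdamsBuchholzKoteckyMuller2019, Lemma 8.1 (proof)] -/
def scaleRatio (d L : ℕ) : ℝ := 2 / Real.sqrt ((L : ℝ) ^ (d - 2))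

/-- **`𝔥_{k+1} = κ_L 𝔥_k`.** [cite: AdamsBuchholzKoteckyMuller2019, Ch. 6.4 (6.40)] -/
theorem fieldWt_succ {h L : ℝ} (hL : 0 < L) (d k : ℕ) :
    fieldWt h L d (k + 1) = 2 / Real.sqrt (L ^ (d - 2)) * fieldWt h L d k := by
  unfold fieldWt
  rw [hScale_succ, show (k + 1) * (d - 2) = k * (d - 2) + (d - 2) by ring, pow_add,
    Real.sqrt_mul (by positivity)]
  have h1 : 0 < Real.sqrt (L ^ (k * (d - 2))) := Real.sqrt_pos.2 (by positivity)
  have h2 : 0 < Real.sqrt (L ^ (d - 2)) := Real.sqrt_pos.2 (by positivity)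
  field_simp

/-- `κ_L > 0`. [cite: AdamsBuchholzKoteckyMuller2019, Lemma 8.1] -/
theorem scaleRatio_pos {d L : ℕ} (hL : 0 < L) : 0 < scaleRatio d L := by
  unfold scaleRatio
  exact div_pos two_pos (Real.sqrt_pos.2 (by positivity))

/-- `κ_L ≤ 1` for `d ≥ 3`, `L ≥ 4` (`4 ≤ L^{d−2}`). [cite: AdamsBuchholzKoteckyMuller2019, Lemma 8.1] -/
theorem scaleRatio_le_one {d L : ℕ} (hd : 3 ≤ d) (hL : 4 ≤ L) : scaleRatio d L ≤ 1 := by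
  unfold scaleRatio
  have h4 : (4 : ℝ) ≤ (L : ℝ) ^ (d - 2) := by
    have hL' : (4 : ℝ) ≤ L := by exact_mod_cast hL
    calc (4 : ℝ) = 4 ^ 1 := (pow_one _).symm
      _ ≤ (L : ℝ) ^ 1 := by gcongr
      _ ≤ (L : ℝ) ^ (d - 2) := pow_le_pow_right₀ (by linarith) (by omega)
  have h2 : (2 : ℝ) ≤ Real.sqrt ((L : ℝ) ^ (d - 2)) := by
    rw [show (2 : ℝ) = Real.sqrt 4 by rw [show (4 : ℝ) = 2 ^ 2 by norm_num, Real.sqrt_sq two_pos.le]]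
    exact Real.sqrt_le_sqrt h4
  rw [div_le_one (by linarith)]
  exact h2

/-- `𝔥_{k+1} = κ_L 𝔥_k` for a natural base `L`. [cite: AdamsBuchholzKoteckyMuller2019, Ch. 6.4 (6.40)] -/
theorem fieldWt_succ_nat {h : ℝ} {L : ℕ} (hL : 0 < L) (d k : ℕ) :
    fieldWt h (L : ℝ) d (k + 1) = scaleRatio d L * fieldWt h (L : ℝ) d k := by
  unfold scaleRatio
  exact fieldWt_succ (by exact_mod_cast hL) d k

/-- **The single-block contraction constant of the concrete data**, `1536 · c_G` with
`c_G = blockContrConst` at the ratios `𝔥'/𝔥 = κ_L`, `R/R' = 1/L` and the box constants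
`C₁ = 2R + 2`, `C₀ = 2R + 2 + (⌊d/2⌋ + 1)`; it depends on `d, L, R` only and is `O(L^{−d'} + L^{−3d/2})`
([ABKM19] (10.10): `C_1 L^{−d'} + 8(C_2+1)L^{−3d/2}`).
[cite: AdamsBuchholzKoteckyMuller2019, Lemma 10.4 (10.14)] -/
def abkmContrConst (d L R : ℕ) : ℝ :=
  1536 * blockContrConst d 1 (scaleRatio d L) 1 L L (scaleRatio d L) ((2 * R + 2 : ℕ) : ℝ)
    (((2 * R + 2 : ℕ) : ℝ) + ((d / 2 + 1 : ℕ) : ℝ))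

/-- `blockContrConst` depends on the gauges only through the ratio `(𝔥'/𝔥)(R/R')`.
[cite: AdamsBuchholzKoteckyMuller2019, Lemma 10.3 (10.10)] -/
theorem blockContrConst_eq_of_ratio (d : ℕ) {𝔥 𝔥' R R' L κ C₁ C₀ a : ℝ}
    (h : 𝔥' / 𝔥 * (R / R') = a / L) :
    blockContrConst d 𝔥 𝔥' R R' L κ C₁ C₀ = blockContrConst d 1 a 1 L L κ C₁ C₀ := by
  have h' : a / 1 * (1 / L) = a / L := by rw [div_one, one_div, div_eq_mul_inv]
  unfold blockContrConst pi2ContrFactor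
  rw [h, h']

/-! ## Arithmetic of the radii and boxes -/

/-- **The box `B*` and its test polynomials fit into the next block**: `2(L^k + 2r_k + p) ≤ L^{k+1}`
for `L ≥ 2^{d+3} + 16R`, `p ≤ R`. [cite: AdamsBuchholzKoteckyMuller2019, Ch. 6.2 (6.26)] -/
theorem two_mul_box_add_le {L R p : ℕ} (hL : 2 ^ (d + 3) + 16 * R ≤ L) (hpR : p ≤ R) (k : ℕ) :
    2 * (L ^ k + 2 * starRad R L d k + p) ≤ L ^ (k + 1) := by
  have h8 : 8 ≤ 2 ^ (d + 3) := by
    calc 8 = 2 ^ 3 := by norm_num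
      _ ≤ 2 ^ (d + 3) := Nat.pow_le_pow_right (by norm_num) (by omega)
  have h8d : 2 ^ (d + 3) = 2 ^ d * 8 := by rw [pow_add]; norm_num
  have h2d' : 2 ^ (d + 2) = 2 ^ d * 4 := by rw [pow_add]; norm_num
  rcases k with _ | _ | k
  · rw [starRad_zero, pow_zero, zero_add, pow_one]; omega
  · rw [starRad_one, pow_one]
    have : 2 * (L + 2 * (2 ^ d + R) + p) ≤ 3 * L := by omega
    calc 2 * (L + 2 * (2 ^ d + R) + p) ≤ 3 * L := this
      _ ≤ L * L := Nat.mul_le_mul_right L (by omega)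
      _ = L ^ (1 + 1) := by ring
  · rw [starRad_add_two]
    have hLk : 1 ≤ L ^ (k + 1) := Nat.one_le_pow _ _ (by omega)
    have h1 : 2 * (L ^ (k + 2) + 2 * (2 ^ d * L ^ (k + 1)) + p) ≤
        L ^ (k + 1) * (2 * L + 2 ^ (d + 2) + 2 * p) := by
      rw [pow_succ L (k + 1)]; nlinarith
    have h2 : 2 * L + 2 ^ (d + 2) + 2 * p ≤ L * L := by nlinarith
    calc 2 * (L ^ (k + 2) + 2 * (2 ^ d * L ^ (k + 1)) + p)
        ≤ L ^ (k + 1) * (2 * L + 2 ^ (d + 2) + 2 * p) := h1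
      _ ≤ L ^ (k + 1) * (L * L) := Nat.mul_le_mul_left _ h2
      _ = L ^ (k + 2 + 1) := by ring

/-- **The side of the box `B*`**: `2(⌊(L^k − 1)/2⌋ + r_k) ≤ (2R + 2) L^k` for `L ≥ 2^{d+3} + 16R`.
[cite: AdamsBuchholzKoteckyMuller2019, Ch. 6.2 (6.25)] -/
theorem boxSide_le {L R : ℕ} (hL : 2 ^ (d + 3) + 16 * R ≤ L) (k : ℕ) :
    2 * ((L ^ k - 1) / 2 + starRad R L d k) ≤ (2 * R + 2) * L ^ k := by
  have h8d : 2 ^ (d + 3) = 2 ^ d * 8 := by rw [pow_add]; norm_num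
  have hdiv : 2 * ((L ^ k - 1) / 2) ≤ L ^ k := by
    have := Nat.mul_div_le (L ^ k - 1) 2; omega
  rcases k with _ | _ | k
  · rw [starRad_zero, pow_zero]; omega
  · rw [starRad_one, pow_one]
    rw [pow_one] at hdiv
    have h2 : 2 * (2 ^ d + R) ≤ L := by omega
    nlinarith
  · rw [starRad_add_two]
    have h2 : 2 * 2 ^ d ≤ L := by omega
    have h1 : 2 * (2 ^ d * L ^ (k + 1)) ≤ L ^ (k + 2) := by
      rw [pow_succ L (k + 1)]
      nlinarith [Nat.zero_le (L ^ (k + 1))]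
    nlinarith [Nat.zero_le (L ^ (k + 2))]

/-! ## Lemma 10.1 for the concrete data -/

/-- **[ABKM19] Lemma 10.1 for the torus data.**  Let `d ≥ 3`, `L` odd with `L ≥ 2^{d+3} + 16R`,
`M = L^N`, `k + 1 ≤ N`, gauge order `⌊d/2⌋ + 2 ≤ p` with `p + d ≤ M_ord ≤ R`, Taylor order `r₀ ≥ 3`,
`h > 0` with `h² ≥ h₀²`, `θ̄ > 0`, `λ > 0`; let the weight tower satisfy the conclusions of Theorem 7.1
(`AbkmWeightBounds`, integration constant `A_𝒫 ≥ 0`) and let the large-set parameter satisfy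
`A ≥ 1`, `A ≥ A_𝒫`, `2^{L^d} A_𝒫 A^{−(1−1/η)} ≤ 1` for a closure gain `η > 0` valid at scale `k`
(`η|X̄|_{k+1} ≤ |X|_k` for large connected `k`-polymers; Brydges' Lemma 6.15).  Let `D` be the step
data of scale `k` (`s = L^k`, ratio `L`, kernel `𝒞_{k+1}`, reference block `B_{x₀}`, base point the
corner of `B_{x₀}*`).  Then for every translation-invariant, local, `C^{r₀}` activity `K` with `C^{r₀}`
fluctuation integrals and `‖K‖_k^{(A)} ≤ C`:
`‖C_k K‖_{k+1}^{(A)} ≤ C · (L^d · A_𝒫 · abkmContrConst d L R + ε(A))`, `ε = largePartEps d L A A_𝒫 η`.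
[cite: AdamsBuchholzKoteckyMuller2019, Lemma 10.1] -/
theorem weakNormLE_opC_abkm {L N Mord R n p r₀ : ℕ} {θbar lam μ δ₁ δ₀ A𝒫 h A : ℝ}
    {𝒞 : ℕ → (Fin d → ZMod M) → ℝ} (hd : 3 ≤ d) (hLodd : Odd L) (hL : 2 ^ (d + 3) + 16 * R ≤ L)
    (hM : M = L ^ N) {k : ℕ} (hkN : k + 1 ≤ N) (hp : d / 2 + 2 ≤ p) (hpM : p + d ≤ Mord)
    (hMR : Mord ≤ R) (hr₀ : 3 ≤ r₀) (hθbar : 0 < θbar) (hlam : 0 < lam)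
    (hB : AbkmWeightBounds L N Mord R n θbar lam μ δ₁ δ₀ A𝒫 𝒞
      (abkmWeightData L N Mord R θbar (schedDelta δ₀ δ₁ N) 𝒞))
    (hδ₀ : 0 < δ₀) (hδ₁ : 0 < δ₁) (hh : 0 < h) (hh0 : hZeroSq d R δ₀ δ₁ ≤ h ^ 2)
    (hA𝒫 : 0 ≤ A𝒫) (hA : 1 ≤ A) (hA𝒫A : A𝒫 ≤ A) {η : ℝ} (hη : 0 < η)
    (hsmall : (2 : ℝ) ^ (L ^ d) * (A𝒫 * A ^ (-(1 - η⁻¹) : ℝ)) ≤ 1)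
    (hgain : ∀ X : Finset (Fin d → ZMod M), IsPolymer (L ^ k) X → IsConn X →
      2 ^ d < (blocks (L ^ k) X).card →
        η * ((blocks (L * L ^ k) (closure (L * L ^ k) X)).card : ℝ) ≤ (blocks (L ^ k) X).card)
    -- the step data of scale `k`
    (D : StepData d M) (hDs : D.s = L ^ k) (hDL : D.L = L) (hD𝒞 : D.𝒞 = 𝒞 (k + 1))
    {x₀ : Fin d → ZMod M} (hB₀ : D.B₀ = blockOf (L ^ k) x₀)
    (hc₀ : D.c₀ = boxCorner (L ^ k) (starRad R L d k) x₀)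
    -- the activity
    {K : Finset (Fin d → ZMod M) → ((Fin d → ZMod M) → ℝ) → ℂ} {C : ℝ} (hC : 0 ≤ C)
    (hK : WeakNormLE (abkmNormParams L N Mord R p r₀ h θbar A (schedDelta δ₀ δ₁ N) 𝒞) k K C)
    (hKt : TransInv (L ^ k) K) (hKd : ∀ X, ContDiff ℝ r₀ (K X))
    (hKloc : ∀ X, IsPolymer (L ^ k) X → IsConn X →
      IsGaugeLocal ((abkmNormParams L N Mord R p r₀ h θbar A (schedDelta δ₀ δ₁ N) 𝒞).gauge k X) (K X))
    (hRd : ∀ X, ContDiff ℝ r₀ (fluct (𝒞 (k + 1)) (K X))) :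
    WeakNormLE (abkmNormParams L N Mord R p r₀ h θbar A (schedDelta δ₀ δ₁ N) 𝒞) (k + 1) (opC D K)
      (C * ((L : ℝ) ^ d * (A𝒫 * abkmContrConst d L R) + largePartEps d L A A𝒫 η)) := by
  set P := abkmNormParams L N Mord R p r₀ h θbar A (schedDelta δ₀ δ₁ N) 𝒞 with hP
  -- sizes
  have h8 : 8 ≤ 2 ^ (d + 3) := by
    calc 8 = 2 ^ 3 := by norm_num
      _ ≤ 2 ^ (d + 3) := Nat.pow_le_pow_right (by norm_num) (by omega)
  have h2dle : 2 ^ d ≤ 2 ^ (d + 3) := Nat.pow_le_pow_right (by norm_num) (by omega)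
  have hL4 : 4 ≤ L := by omega
  have hLR : 2 ^ d + R ≤ L := by omega
  have hL0 : (0 : ℝ) < L := by exact_mod_cast hLodd.pos
  have hL1 : (1 : ℝ) ≤ L := by exact_mod_cast hLodd.pos
  have hpR : p ≤ R := by omega
  have hd2 : 2 ≤ d := by omega
  -- the torus at scale `k + 1`
  obtain ⟨t, ht⟩ : ∃ t, N = (k + 1) + t := ⟨N - (k + 1), by omega⟩
  have hMt : M = P.L ^ (k + 1) * L ^ t := by
    show M = L ^ (k + 1) * L ^ t
    rw [← pow_add, ← ht]; exact hM
  have htodd : Odd (L ^ t) := hLodd.pow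
  -- the step data
  have hDs' : D.s = P.L ^ k := hDs
  have hDL' : D.L = P.L := hDL
  have hB₀' : D.B₀ = blockOf (P.L ^ k) x₀ := hB₀
  have hc₀' : D.c₀ = boxCorner (P.L ^ k) (P.rad k) x₀ := hc₀
  -- kernel facts from Theorem 7.1
  have hk1 : k + 1 ≤ N + 1 := by omega
  have heven_all : ∀ j ∈ Icc 1 (N + 1), ∀ x, 𝒞 j (-x) = 𝒞 j x := fun j hj => (hB.zero_sum_even j hj).2
  have heven : ∀ x, 𝒞 (k + 1) (-x) = 𝒞 (k + 1) x := heven_all (k + 1) (mem_Icc.2 ⟨by omega, hk1⟩)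
  have hnn := hB.multipliers_nonneg
  have hC𝒞 : (Matrix.circulant D.𝒞).PosSemidef := by
    rw [hD𝒞, circulant_eq_mulMat_cExt hk1 heven (N := N)]
    exact GradientFRD.posSemidef_mulMat fun κ => hnn (k + 1) κ
  -- the gauges of the two scales
  have h𝔥k : 0 < P.𝔥 k := fieldWt_pos hh hL0 d k
  have h𝔥 : 0 < P.𝔥 (k + 1) := fieldWt_pos hh hL0 d (k + 1)
  have hsucc : P.𝔥 (k + 1) = scaleRatio d L * P.𝔥 k := fieldWt_succ_nat hLodd.pos d k
  have hκL := scaleRatio_pos (d := d) hLodd.pos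
  have hκL1 := scaleRatio_le_one hd hL4
  have h𝔥le : P.𝔥 (k + 1) ≤ P.𝔥 k := by
    rw [hsucc]; exact mul_le_of_le_one_left h𝔥k.le hκL1
  have hκ₁ : P.𝔥 (k + 1) ≤ scaleRatio d L * P.𝔥 k := hsucc.le
  have hR : 0 < P.R k := by show (0 : ℝ) < (L : ℝ) ^ k; positivity
  have hRsucc : P.R (k + 1) = P.L * P.R k := by
    show (L : ℝ) ^ (k + 1) = (L : ℕ) * (L : ℝ) ^ k; rw [pow_succ']
  have hratio : P.𝔥 (k + 1) / P.𝔥 k * (P.R k / P.R (k + 1)) = scaleRatio d L / (P.L : ℝ) := by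
    show fieldWt h (L : ℝ) d (k + 1) / fieldWt h (L : ℝ) d k * ((L : ℝ) ^ k / (L : ℝ) ^ (k + 1)) =
      scaleRatio d L / L
    rw [fieldWt_succ_nat hLodd.pos d k, pow_succ']
    exact two_scale_ratio (fieldWt_pos hh hL0 d k) (by positivity) hL0
  have hθ : P.𝔥 (k + 1) / P.𝔥 k * (P.R k / P.R (k + 1)) ≤ 1 := by
    rw [hratio]
    show scaleRatio d L / (L : ℝ) ≤ 1
    rw [div_le_one hL0]
    exact hκL1.trans hL1
  have hp' : d / 2 + 2 ≤ P.p := hp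
  have hr₀' : 3 ≤ P.r₀ := hr₀
  have hrad : P.rad k ≤ P.rad (k + 1) := starRad_le_succ hLR k
  have hrad' : P.rad k + (2 ^ d - 1) * P.L ^ k ≤ P.rad (k + 1) := starRad_add_le_succ hLR k
  -- the box `B*`
  have hbox := two_mul_box_add_le (d := d) hL hpR k
  have hside := boxSide_le (d := d) hL k
  have hLN : L ^ (k + 1) ≤ M := by rw [hM]; exact Nat.pow_le_pow_right hLodd.pos hkN
  have hLk1 : 1 ≤ L ^ k := Nat.one_le_pow _ _ hLodd.pos
  have hdiv : 2 * ((L ^ k - 1) / 2) + 1 ≤ L ^ k := by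
    have := Nat.mul_div_le (L ^ k - 1) 2; omega
  have hwrap : 4 * ((P.L ^ k - 1) / 2 + P.rad k) < M := by
    show 4 * ((L ^ k - 1) / 2 + starRad R L d k) < M
    omega
  have hroom : ((2 * ((P.L ^ k - 1) / 2 + P.rad k) : ℕ) + (P.p : ℤ)) * 2 < M := by
    show ((2 * ((L ^ k - 1) / 2 + starRad R L d k) : ℕ) + (p : ℤ)) * 2 < (M : ℤ)
    have h2 : (2 * ((L ^ k - 1) / 2 + starRad R L d k) + p) * 2 < M := by omega
    exact_mod_cast h2
  have hC₁ : (0 : ℝ) ≤ ((2 * R + 2 : ℕ) : ℝ) := Nat.cast_nonneg _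
  have hρ : ((2 * ((P.L ^ k - 1) / 2 + P.rad k) : ℕ) : ℝ) ≤ ((2 * R + 2 : ℕ) : ℝ) * P.R k := by
    show ((2 * ((L ^ k - 1) / 2 + starRad R L d k) : ℕ) : ℝ) ≤ ((2 * R + 2 : ℕ) : ℝ) * (L : ℝ) ^ k
    exact_mod_cast hside
  have hC₀ : (1 : ℝ) ≤ ((2 * R + 2 : ℕ) : ℝ) + ((d / 2 + 1 : ℕ) : ℝ) := by
    have : (1 : ℝ) ≤ ((2 * R + 2 : ℕ) : ℝ) := by exact_mod_cast (show 1 ≤ 2 * R + 2 by omega)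
    linarith [(Nat.cast_nonneg (d / 2 + 1) : (0 : ℝ) ≤ _)]
  have hρ0 : ((2 * ((P.L ^ k - 1) / 2 + P.rad k) : ℕ) : ℝ) + (d / 2 + 1 : ℕ) ≤
      (((2 * R + 2 : ℕ) : ℝ) + ((d / 2 + 1 : ℕ) : ℝ)) * P.R k := by
    have hLk : (1 : ℝ) ≤ (L : ℝ) ^ k := one_le_pow₀ hL1
    have h1 : ((d / 2 + 1 : ℕ) : ℝ) ≤ ((d / 2 + 1 : ℕ) : ℝ) * (L : ℝ) ^ k :=
      le_mul_of_one_le_right (Nat.cast_nonneg _) hLk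
    calc ((2 * ((P.L ^ k - 1) / 2 + P.rad k) : ℕ) : ℝ) + (d / 2 + 1 : ℕ)
        ≤ ((2 * R + 2 : ℕ) : ℝ) * P.R k + ((d / 2 + 1 : ℕ) : ℝ) * (L : ℝ) ^ k := add_le_add hρ h1
      _ = (((2 * R + 2 : ℕ) : ℝ) + ((d / 2 + 1 : ℕ) : ℝ)) * P.R k := by
          show ((2 * R + 2 : ℕ) : ℝ) * (L : ℝ) ^ k + _ = _ * (L : ℝ) ^ k; ring
  -- the three discharged hypothesis shapes and the weights
  have hWd := hB.dominated
  have hWm := hB.monotone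
  have hw6 : NextWeightDominates P k := nextWeightDominates_abkm hB hLodd hLR hMt htodd p r₀ h A
  have hw9 : ∀ U, IsPolymer (P.L ^ (k + 1)) U → W9At P k U := fun U hU =>
    w9At_abkm hd2 hLodd hL hM hkN hpM hB hδ₀ hδ₁ hh hh0 r₀ A hU
  have hint : IntegrationProperty P k D.𝒞 A𝒫 := by
    rw [hD𝒞]; exact integrationProperty_abkm hθbar hlam hB hk1 p r₀ h A
  -- Lemma 10.1 (ray form)
  have hmain := weakNormLE_opC_of_ray P hMt hLodd htodd D hDs' hDL' hB₀' hc₀' hC𝒞 h𝔥 h𝔥le hκ₁ hR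
    hRsucc hθ hp' hr₀' hrad hrad' hwrap hroom hC₁ hρ hC₀ hρ0 hWd hWm hw6 hw9 hA𝒫 hA𝒫A hA hη hint
    hsmall hgain hC hK (by rwa [hDs]) hKd hKloc (by rw [hD𝒞]; exact hRd)
  -- the constant is `k`-independent
  have hconst : 1536 * A𝒫 * blockContrConst d (P.𝔥 k) (P.𝔥 (k + 1)) (P.R k) (P.R (k + 1)) P.L
      (scaleRatio d L) ((2 * R + 2 : ℕ) : ℝ) (((2 * R + 2 : ℕ) : ℝ) + ((d / 2 + 1 : ℕ) : ℝ)) =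
      A𝒫 * abkmContrConst d L R := by
    rw [blockContrConst_eq_of_ratio d hratio]
    show 1536 * A𝒫 * blockContrConst d 1 (scaleRatio d L) 1 (L : ℝ) (L : ℝ) (scaleRatio d L)
        ((2 * R + 2 : ℕ) : ℝ) (((2 * R + 2 : ℕ) : ℝ) + ((d / 2 + 1 : ℕ) : ℝ)) =
      A𝒫 * (1536 * blockContrConst d 1 (scaleRatio d L) 1 (L : ℝ) (L : ℝ) (scaleRatio d L)
        ((2 * R + 2 : ℕ) : ℝ) (((2 * R + 2 : ℕ) : ℝ) + ((d / 2 + 1 : ℕ) : ℝ)))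
    ring
  rw [hconst] at hmain
  exact hmain

end Literature.MathematicalPhysics.StatisticalMechanics.GradientRG

end
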